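import Mathlib
import HarnessLib

/-!
# Magnen–Rivasseau–Sénéor, *Construction of YM₄ with an infrared cutoff* (CMP 155, 1993), Appendix 1 — the two «rigorous
# inequalities» (A.2) and (A.6) that reduce the Feynman-gauge (ζ = 1) case of Lemma VI.1 to explicit one-dimensional integrals, the
# homothetic bounds (A.27) and the zero set (A.28) PROVED, and the background-field propagator decay (A.29) AS PRINTED (typed)

statement-level skeleton of published theorems with citation tags; proofs where landed; nothing here is a claim about the
Yang–Mills mass gap, about continuum YM₄ on T⁴, or about the Clay problem

**Citation header (reproduction of PUBLISHED work).** J. Magnen, V. Rivasseau, R. Sénéor, *Construction of YM₄ with an infrared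
cutoff*, Commun. Math. Phys. **155** (1993) 325–383 [MagnenRivasseauSeneor1993], Appendix 1 pp. 378–383. Loci «p.NNN [PDF nn] tl.k» =
journal page, PDF page (= journal page − 324), text-layer line of the held scan `paper:magnen1993-cmp155-mrs-ym4-infrared-cutoff` (PDF
sha256 fa4ddac3…); displays read on the page images `run/shared/lean/pub/lit-balaban/inprint/lit-balaban-p14/renders-cmp155/p54_full_s6.png`,
`p55_full_s6.png`, `p58_full_s6.png`, `p59_full_s6.png`. Cell pub-balaban-gaps (YM blitz, track G3), seat mrs-lit-2; companion record
`run/shared/lean/pub/pub-balaban-gaps/g3/MRS-AS-PRINTED-estimates.md`; the Sect. VI statements these serve are in `MRS93StabilityEstimate.lean`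
(`Stability.LemmaVI1Printed`, the determinant `Stability.onePlusBetaP_feynman` = (VI.15)).

**Grade of record (lit-balaban YM-INPRINT.md row D1).** Appendix 1: **PROOF** (ζ = 1 case, complete elementary computation; (A.5) needs
η < 1/88 and c > 9/2). This file kernel-checks the inequalities by which the appendix REPLACES the exact integrands by simpler ones
((A.2), (A.6)), the flat-space form of (A.27) and the zero set (A.28), and types the decay (A.29) as a predicate; the contour-integral
evaluations (A.3)–(A.5), (A.7)–(A.26) are not formalised.

**What the paper prints (verbatim; displays from the page images).**
* p.378 [PDF 54] tl.27–37: «In this appendix we provide some explicit bounds and computations of the determinants considered in Sect. VI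
  in the simpler case of the Feynman gauge ζ = 1. We start by a warm up: the case t = 0. … (A.1) We perform first at fixed β and κ,
  hence fixed v, the angular integral over θ. In order to simplify slightly the computation we remark first that we have the rigorous
  inequality (since 0 ≤ κ ≤ 1): −2 ln(1 + 2β − 4βκ cos²θ + β²) ≤ −2 ln(1 − 2β cos 2θ + β²). (A.2)»
* p.379 [PDF 55] tl.31–35: «Let us return to the general case ζ = 1 but t ≠ 0. The third order polynomial in β in (VI.15) becomes if we
  put τ = t²: [1 + 2β(1 − 2κ(cos²θ + τ sin²θ cos²φ)) + β²] + βτ[2 + β(τ + 3 − 4κ(cos²θ + sin²θ cos²φ)) + β²(1 + τ)]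
  ≥ [1 + 2β(1 − 2(cos²θ + τ sin²θ cos²φ)) + β²] + 7βτ/4. (A.6)»
* p.382 [PDF 58] tl.26–31 + p.383 [PDF 59] tl.1–7: «We want also to derive a bound showing the strict positivity of −Δ_B^{homothetic} in
  a constant field B, unless all the components of B are in the same direction in su(2) space, and p is then exactly aligned with the
  corresponding (unique) vector λB. For this we use the fact that δ_{μν}D² − 10/13 ∇_μ∇_ν ≥ 3/13 D²; δ_{μν}p² − 10/13 p_μp_ν ≤ 23/13 p²
  (A.27) in order to show that the normalized operator (−Δ_B^{homothetic})(−Δ^{homothetic})^{−1} is bounded up to a factor (3/23)^{12} exactly by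
  the same bound as in the Feynman case of ordinary Laplacians. … In particular this proves that the determinant of
  (−Δ_B^{homothetic})(−Δ^{homothetic})^{−1} is bounded away from 0 up to a constant factor by the bound (A.6). The only zeroes of the
  right-hand side of (A.6) ([1 + 2β(1 − 2(cos²θ + τ sin²θ cos²φ)) + β²] + 7βτ/4) (A.28) occur for τ = 0, β = 1 and θ = 0, which correspond
  to the announced case of all components of B aligned in su(2) space (since τ = 0) and B aligned with the momentum p (β = 1, θ = 0).»
* p.383 tl.11–18, (A.29): «If we use a cutoff function κ_B^m as in (V.2) with correct scaling around this translated zero of the operator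
  (−Δ_B^{homothetic}) with constant background, we obtain the correct polynomial bounds on the spatial decay using integration by parts on
  the cutoff function: κ_B^m ∗ (−Δ_B^{homothetic})^{−1}(x, y) ≤ K_q M^{2m} (1/(1 + M^m|x − y|))^q. (A.29) It is this decrease which is finally
  used in the horizontal cluster expansion.» (cited from Sect. V.B/V.C p.364 tl.1–3, 16–18 as «the good spatial decrease (A.29) of the
  homothetic propagator in a fixed background field».)

**What is proved here (zero `sorry`, zero named facts).**
* `ineq_A2_arg` — the argument comparison behind (A.2): `1 − 2β cos 2θ + β² ≤ 1 + 2β − 4βκ cos²θ + β²` for `β ≥ 0`, `κ ≤ 1` (with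
  `cos 2θ = 2cos²θ − 1` it reads `4β(1 − κ)cos²θ ≥ 0`); `ineq_A2` — (A.2) itself, `−2 ln(1 + 2β − 4βκcos²θ + β²) ≤ −2 ln(1 − 2β cos 2θ +
  β²)`, for `β ≥ 0`, `κ ≤ 1`, at every `θ` where the right-hand argument is positive (it is `(1 − β)² + 4β sin²θ ≥ 0`, vanishing only
  at `β = 1`, `sin θ = 0`, where the printed right side is `−2 ln 0`; reading (i)).
* `ineq_A6` — (A.6) for `β ≥ 0`, `κ ≤ 1`, `τ ≥ 0` and all angles: the `κ`-monotonicity of the first bracket plus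
  `2 + β(τ + 3 − 4κ(cos²θ + sin²θcos²φ)) + β²(1 + τ) ≥ 2 − β + β² ≥ 7/4` (`cos²θ + sin²θcos²φ ≤ 1`).
* `ineq_A27_lower`, `ineq_A27_upper` — (A.27) for ordinary momenta (the flat, `B = 0` form of both halves), as quadratic-form inequalities
  on `ℝ⁴`: `(3/13)|p|²|v|² ≤ |p|²|v|² − (10/13)⟨p, v⟩² ≤ (23/13)|p|²|v|²` (Cauchy–Schwarz); the covariant half with `D`, `∇` is an operator
  statement not typed here.
* `A28_eq`, `A28_nonneg`, `A28_eq_zero_iff` — (A.28): the right-hand side of (A.6) equals `(1 − β)² + 4β sin²θ(1 − τcos²φ) + 7βτ/4`, is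
  `≥ 0` for `β ≥ 0`, `0 ≤ τ ≤ 1`, and vanishes iff `β = 1 ∧ τ = 0 ∧ sin θ = 0` — «The only zeroes … occur for τ = 0, β = 1 and θ = 0»
  (θ = 0 mod π).
* `BackgroundSliceDecay` / `IneqA29Printed` — (A.29) as a predicate on the sliced constant-background homothetic propagator kernel family
  (index `m`, kernel of `x − y ∈ ℝ⁴`; `∀ q, ∃ K_q` as in (II.27)/(VII.1)); not proved (integration by parts on `κ_B^m`).

**Readings (declared).** (i) (A.2) is typed with the side condition `0 < 1 − 2β cos 2θ + β²` (true off a null set); Lean's `Real.log 0 = 0`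
would otherwise make the boundary case a different (junk) statement. (ii) `τ = t² ∈ [0, 1]` since `t ∈ [0, 1]` (p.372).

**What is NOT claimed.** (A.1), (A.3)–(A.5), (A.7)–(A.26): the explicit integrals, the closed forms `G(β)` (A.4), `G′ < 0`, the final
bound (A.5) with its thresholds `c > 9/2`, `η < 1/88`, the residue computations; the covariant half of (A.27); the factor `(3/23)^{12}`
comparison of determinants; (A.29) itself — none is formalised. Nothing here bears on Bałaban's papers.
-/

noncomputable section

open Real

namespace Literature.MathematicalPhysics.QuantumFieldTheory.MagnenRivasseauSeneor1993

namespace AppendixOne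

/-- The comparison of arguments behind **(A.2)** p.378 [PDF 54]: for `β ≥ 0` and `κ ≤ 1`,
`1 − 2β cos 2θ + β² ≤ 1 + 2β − 4βκ cos²θ + β²` (equivalently `0 ≤ 4β(1 − κ)cos²θ`, using `cos 2θ = 2cos²θ − 1`).
[cite: MagnenRivasseauSeneor1993, App. 1 (A.2) p.378] -/
theorem ineq_A2_arg {β κ : ℝ} (hβ : 0 ≤ β) (hκ : κ ≤ 1) (θ : ℝ) :
    1 - 2 * β * Real.cos (2 * θ) + β ^ 2 ≤ 1 + 2 * β - 4 * β * κ * Real.cos θ ^ 2 + β ^ 2 := by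
  rw [Real.cos_two_mul]
  have hc : 0 ≤ Real.cos θ ^ 2 := sq_nonneg _
  nlinarith [mul_nonneg (mul_nonneg hβ (sub_nonneg.2 hκ)) hc]

/-- **(A.2)** p.378 [PDF 54] tl.35–37, verbatim: «we remark first that we have the rigorous inequality (since 0 ≤ κ ≤ 1):
`−2 ln(1 + 2β − 4βκ cos²θ + β²) ≤ −2 ln(1 − 2β cos 2θ + β²)`. (A.2)» — for `β ≥ 0`, `κ ≤ 1` (of the printed `0 ≤ κ ≤ 1` only the
upper bound is used), at every `θ` with `1 − 2β cos 2θ + β² > 0` (reading (i): this argument is `(1 − β)² + 4β sin²θ`, positive off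
`β = 1 ∧ sin θ = 0`).
[cite: MagnenRivasseauSeneor1993, App. 1 (A.2) p.378] -/
theorem ineq_A2 {β κ θ : ℝ} (hβ : 0 ≤ β) (hκ : κ ≤ 1) (hpos : 0 < 1 - 2 * β * Real.cos (2 * θ) + β ^ 2) :
    -2 * Real.log (1 + 2 * β - 4 * β * κ * Real.cos θ ^ 2 + β ^ 2) ≤ -2 * Real.log (1 - 2 * β * Real.cos (2 * θ) + β ^ 2) := by
  have hle := ineq_A2_arg hβ hκ θ
  have hlog := Real.log_le_log hpos hle
  linarith

/-- The right-hand argument of (A.2) is `(1 − β)² + 4β sin²θ` — hence `≥ 0`, and `> 0` unless `β = 1` and `sin θ = 0`.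
[cite: MagnenRivasseauSeneor1993, App. 1 (A.2) p.378] -/
theorem A2_arg_eq (β θ : ℝ) : 1 - 2 * β * Real.cos (2 * θ) + β ^ 2 = (1 - β) ^ 2 + 4 * β * Real.sin θ ^ 2 := by
  rw [Real.cos_two_mul, Real.cos_sq']
  ring

/-- **(A.6)** p.379 [PDF 55] tl.31–35, verbatim: «The third order polynomial in β in (VI.15) becomes if we put τ = t²:
`[1 + 2β(1 − 2κ(cos²θ + τ sin²θ cos²φ)) + β²] + βτ[2 + β(τ + 3 − 4κ(cos²θ + sin²θ cos²φ)) + β²(1 + τ)]`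
`≥ [1 + 2β(1 − 2(cos²θ + τ sin²θ cos²φ)) + β²] + 7βτ/4`. (A.6)» — for `β ≥ 0`, `κ ≤ 1`, `τ ≥ 0` and all `θ, φ` (of the printed ranges
`0 ≤ κ ≤ 1`, `τ = t² ∈ [0,1]` only these bounds are used).
[cite: MagnenRivasseauSeneor1993, App. 1 (A.6) p.379] -/
theorem ineq_A6 {β κ τ : ℝ} (hβ : 0 ≤ β) (hκ : κ ≤ 1) (hτ0 : 0 ≤ τ) (θ φ : ℝ) :
    (1 + 2 * β * (1 - 2 * (Real.cos θ ^ 2 + τ * Real.sin θ ^ 2 * Real.cos φ ^ 2)) + β ^ 2) + 7 * β * τ / 4 ≤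
      (1 + 2 * β * (1 - 2 * κ * (Real.cos θ ^ 2 + τ * Real.sin θ ^ 2 * Real.cos φ ^ 2)) + β ^ 2) +
        β * τ * (2 + β * (τ + 3 - 4 * κ * (Real.cos θ ^ 2 + Real.sin θ ^ 2 * Real.cos φ ^ 2)) + β ^ 2 * (1 + τ)) := by
  set A := Real.cos θ ^ 2 + τ * Real.sin θ ^ 2 * Real.cos φ ^ 2 with hA
  set A' := Real.cos θ ^ 2 + Real.sin θ ^ 2 * Real.cos φ ^ 2 with hA'
  have hc2 : 0 ≤ Real.cos θ ^ 2 := sq_nonneg _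
  have hs2 : 0 ≤ Real.sin θ ^ 2 := sq_nonneg _
  have hcφ : 0 ≤ Real.cos φ ^ 2 := sq_nonneg _
  have hcφ1 : Real.cos φ ^ 2 ≤ 1 := by
    rw [sq_le_one_iff_abs_le_one]
    exact Real.abs_cos_le_one φ
  have hpyth : Real.cos θ ^ 2 + Real.sin θ ^ 2 = 1 := Real.cos_sq_add_sin_sq θ
  have hA0 : 0 ≤ A := by
    rw [hA]
    have : 0 ≤ τ * Real.sin θ ^ 2 * Real.cos φ ^ 2 := by positivity
    linarith
  have hA'1 : A' ≤ 1 := by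
    rw [hA']
    have : Real.sin θ ^ 2 * Real.cos φ ^ 2 ≤ Real.sin θ ^ 2 * 1 := mul_le_mul_of_nonneg_left hcφ1 hs2
    linarith
  -- first bracket: −4βκA ≥ −4βA
  have h1 : 1 + 2 * β * (1 - 2 * A) + β ^ 2 ≤ 1 + 2 * β * (1 - 2 * κ * A) + β ^ 2 := by
    have : κ * A ≤ 1 * A := mul_le_mul_of_nonneg_right hκ hA0
    nlinarith
  -- second bracket: 2 + β(τ + 3 − 4κA′) + β²(1 + τ) ≥ 2 − β + β² ≥ 7/4
  have hin : τ + 3 - 4 * κ * A' ≥ -1 := by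
    have : κ * A' ≤ 1 := by
      calc κ * A' ≤ 1 * 1 := mul_le_mul hκ hA'1 (by rw [hA']; positivity) (by norm_num)
        _ = 1 := by norm_num
    linarith
  have h2 : 7 / 4 ≤ 2 + β * (τ + 3 - 4 * κ * A') + β ^ 2 * (1 + τ) := by
    have hb1 : β * (τ + 3 - 4 * κ * A') ≥ β * (-1) := mul_le_mul_of_nonneg_left hin hβ
    have hb2 : β ^ 2 * (1 + τ) ≥ β ^ 2 * 1 := mul_le_mul_of_nonneg_left (by linarith) (sq_nonneg β)
    nlinarith [sq_nonneg (β - 1 / 2)]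
  have h3 : 7 * β * τ / 4 ≤ β * τ * (2 + β * (τ + 3 - 4 * κ * A') + β ^ 2 * (1 + τ)) := by
    have hbt : 0 ≤ β * τ := mul_nonneg hβ hτ0
    have := mul_le_mul_of_nonneg_left h2 hbt
    linarith
  linarith

/-! ## (A.27), (A.28), (A.29) -/

/-- **(A.27), second half, flat form** p.382 [PDF 58] tl.30–31: «δ_{μν}p² − 10/13 p_μp_ν ≤ 23/13 p²» — as a quadratic form on `ℝ⁴`:
`|p|²|v|² − (10/13)⟨p,v⟩² ≤ (23/13)|p|²|v|²` (indeed `≤ |p|²|v|²`). [cite: MagnenRivasseauSeneor1993, App. 1 (A.27) p.382] -/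
theorem ineq_A27_upper (p v : EuclideanSpace ℝ (Fin 4)) :
    ‖p‖ ^ 2 * ‖v‖ ^ 2 - 10 / 13 * inner ℝ p v ^ 2 ≤ 23 / 13 * (‖p‖ ^ 2 * ‖v‖ ^ 2) := by
  have h1 : 0 ≤ inner ℝ p v ^ 2 := sq_nonneg _
  have h2 : 0 ≤ ‖p‖ ^ 2 * ‖v‖ ^ 2 := by positivity
  nlinarith

/-- **(A.27), first half, flat form** («δ_{μν}D² − 10/13 ∇_μ∇_ν ≥ 3/13 D²» at `B = 0`, `D = ∇ = ip`): on `ℝ⁴`,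
`(3/13)|p|²|v|² ≤ |p|²|v|² − (10/13)⟨p,v⟩²` — Cauchy–Schwarz `⟨p,v⟩² ≤ |p|²|v|²`. The covariant statement is not typed.
[cite: MagnenRivasseauSeneor1993, App. 1 (A.27) p.382] -/
theorem ineq_A27_lower (p v : EuclideanSpace ℝ (Fin 4)) :
    3 / 13 * (‖p‖ ^ 2 * ‖v‖ ^ 2) ≤ ‖p‖ ^ 2 * ‖v‖ ^ 2 - 10 / 13 * inner ℝ p v ^ 2 := by
  have hcs : |inner ℝ p v| ≤ ‖p‖ * ‖v‖ := abs_real_inner_le_norm p v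
  have hsq : inner ℝ p v ^ 2 ≤ (‖p‖ * ‖v‖) ^ 2 := by
    rw [← sq_abs]
    exact pow_le_pow_left₀ (abs_nonneg _) hcs 2
  nlinarith

/-- The right-hand side of (A.6) = the polynomial of **(A.28)** p.383 [PDF 59] tl.7–8, rewritten:
`[1 + 2β(1 − 2(cos²θ + τsin²θcos²φ)) + β²] + 7βτ/4 = (1 − β)² + 4β sin²θ (1 − τcos²φ) + 7βτ/4`.
[cite: MagnenRivasseauSeneor1993, App. 1 (A.28) p.383] -/
theorem A28_eq (β τ θ φ : ℝ) :
    (1 + 2 * β * (1 - 2 * (Real.cos θ ^ 2 + τ * Real.sin θ ^ 2 * Real.cos φ ^ 2)) + β ^ 2) + 7 * β * τ / 4 =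
      (1 - β) ^ 2 + 4 * β * (Real.sin θ ^ 2 * (1 - τ * Real.cos φ ^ 2)) + 7 * β * τ / 4 := by
  have hpyth : Real.cos θ ^ 2 = 1 - Real.sin θ ^ 2 := by rw [← Real.cos_sq_add_sin_sq θ]; ring
  rw [hpyth]
  ring

/-- (A.28): the right-hand side of (A.6) is `≥ 0` for `β ≥ 0`, `0 ≤ τ ≤ 1` (all angles). [cite: MagnenRivasseauSeneor1993, App. 1 (A.28) p.383] -/
theorem A28_nonneg {β τ : ℝ} (hβ : 0 ≤ β) (hτ0 : 0 ≤ τ) (hτ1 : τ ≤ 1) (θ φ : ℝ) :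
    0 ≤ (1 + 2 * β * (1 - 2 * (Real.cos θ ^ 2 + τ * Real.sin θ ^ 2 * Real.cos φ ^ 2)) + β ^ 2) + 7 * β * τ / 4 := by
  rw [A28_eq]
  have hcφ1 : Real.cos φ ^ 2 ≤ 1 := by
    rw [sq_le_one_iff_abs_le_one]
    exact Real.abs_cos_le_one φ
  have h1 : 0 ≤ 1 - τ * Real.cos φ ^ 2 := by nlinarith [sq_nonneg (Real.cos φ)]
  have h2 : 0 ≤ Real.sin θ ^ 2 * (1 - τ * Real.cos φ ^ 2) := mul_nonneg (sq_nonneg _) h1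
  positivity

/-- **(A.28)** p.383 [PDF 59] tl.7–11, verbatim: «The only zeroes of the right-hand side of (A.6) ([1 + 2β(1 − 2(cos²θ + τ sin²θ cos²φ)) +
β²] + 7βτ/4) (A.28) occur for τ = 0, β = 1 and θ = 0» — for `β ≥ 0`, `0 ≤ τ ≤ 1`: the polynomial vanishes iff `β = 1`, `τ = 0` and
`sin θ = 0` (θ = 0 mod π; the print's «θ = 0»). [cite: MagnenRivasseauSeneor1993, App. 1 (A.28) p.383] -/
theorem A28_eq_zero_iff {β τ : ℝ} (hβ : 0 ≤ β) (hτ0 : 0 ≤ τ) (hτ1 : τ ≤ 1) (θ φ : ℝ) :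
    (1 + 2 * β * (1 - 2 * (Real.cos θ ^ 2 + τ * Real.sin θ ^ 2 * Real.cos φ ^ 2)) + β ^ 2) + 7 * β * τ / 4 = 0 ↔
      β = 1 ∧ τ = 0 ∧ Real.sin θ = 0 := by
  rw [A28_eq]
  have hcφ1 : Real.cos φ ^ 2 ≤ 1 := by
    rw [sq_le_one_iff_abs_le_one]
    exact Real.abs_cos_le_one φ
  have h1 : 0 ≤ 1 - τ * Real.cos φ ^ 2 := by nlinarith [sq_nonneg (Real.cos φ)]
  have h2 : 0 ≤ Real.sin θ ^ 2 * (1 - τ * Real.cos φ ^ 2) := mul_nonneg (sq_nonneg _) h1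
  constructor
  · intro h
    have ha : 0 ≤ (1 - β) ^ 2 := sq_nonneg _
    have hb : 0 ≤ 4 * β * (Real.sin θ ^ 2 * (1 - τ * Real.cos φ ^ 2)) := by positivity
    have hc : 0 ≤ 7 * β * τ / 4 := by positivity
    have ha0 : (1 - β) ^ 2 = 0 := by linarith
    have hβ1 : β = 1 := by nlinarith [sq_nonneg (1 - β)]
    have hc0 : 7 * β * τ / 4 = 0 := by linarith
    have hτ : τ = 0 := by
      rw [hβ1] at hc0
      linarith
    have hb0 : 4 * β * (Real.sin θ ^ 2 * (1 - τ * Real.cos φ ^ 2)) = 0 := by linarith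
    rw [hβ1, hτ] at hb0
    have hs : Real.sin θ ^ 2 = 0 := by nlinarith
    exact ⟨hβ1, hτ, pow_eq_zero_iff (two_ne_zero) |>.1 hs⟩
  · rintro ⟨rfl, rfl, hs⟩
    simp [hs]

/-- **(A.29)** for ONE `q` and ONE `K_q`: the sliced constant-background homothetic propagator `κ_B^m ∗ (−Δ_B^{hom})^{−1}` (slice `m` of
(V.2)), as a kernel of `x − y ∈ ℝ⁴`, satisfies «`≤ K_q M^{2m}(1/(1 + M^m|x − y|))^q`» (typed on absolute values of scalar entries).
[cite: MagnenRivasseauSeneor1993, App. 1 (A.29) p.383] -/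
def BackgroundSliceDecay (G : ℕ → EuclideanSpace ℝ (Fin 4) → ℝ) (M : ℝ) (q : ℕ) (Kq : ℝ) : Prop :=
  ∀ (m : ℕ) (z : EuclideanSpace ℝ (Fin 4)), |G m z| ≤ Kq * M ^ (2 * m) * (1 / (1 + M ^ m * ‖z‖)) ^ q

/-- **(A.29)** p.383 [PDF 59] tl.13–18, verbatim: «If we use a cutoff function κ_B^m as in (V.2) with correct scaling around this translated
zero of the operator (−Δ_B^{homothetic}) with constant background, we obtain the correct polynomial bounds on the spatial decay using integration
by parts on the cutoff function: `κ_B^m ∗ (−Δ_B^{homothetic})^{−1}(x, y) ≤ K_q M^{2m}(1/(1 + M^m|x − y|))^q`. (A.29) It is this decrease which is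
finally used in the horizontal cluster expansion.» Quantifiers `∀ q, ∃ K_q` (as (II.27), (VII.1)). A typed predicate on the kernel family;
the integration-by-parts estimate is NOT proved here. [cite: MagnenRivasseauSeneor1993, App. 1 (A.29) p.383] -/
def IneqA29Printed (G : ℕ → EuclideanSpace ℝ (Fin 4) → ℝ) (M : ℝ) : Prop :=
  ∀ q : ℕ, ∃ Kq : ℝ, BackgroundSliceDecay G M q Kq

end AppendixOne

end Literature.MathematicalPhysics.QuantumFieldTheory.MagnenRivasseauSeneor1993
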